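import Summits.SmoothPoincare4.SmoothPoincare4.Theses.EntropyRung
import Summits.SmoothPoincare4.SmoothPoincare4.Theorems.EntropyRungSubcylindricalExistenceTransport
import Summits.SmoothPoincare4.SmoothPoincare4.Theorems.EntropyRungSubcylindricalRecognitionOfBamler
import Summits.SmoothPoincare4.SmoothPoincare4.Theorems.EntropyRungNoncompactGapReduction
import Summits.SmoothPoincare4.SmoothPoincare4.Theorems.EntropyRungThreeShrinkerGap
import Summits.SmoothPoincare4.SmoothPoincare4.Theorems.EntropyRungBakryEmeryLogSobolevComplete
import Summits.SmoothPoincare4.SmoothPoincare4.Theorems.SubcylindricalRecognition.Negative.Shape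
import HarnessLib

/-!
# Equivalence audit (crux-strategist q1, 2026-08-17) — crux `EntropyRung.SubcylindricalExistence`
# (ENT, stmt-SmoothPoincare4-10871), witness `Theorems.subcylindricalExistence_iff_spc4`

Companion of `Cruxes/SubcylindricalExistence/EQUIVALENCE-AUDIT-q1.md`. Kernel-checked packaging of the
logical position behind the SUSPECT-EQUIVALENCE flag (nothing new is proved; every ingredient is a tree theorem):

* `spc4_iff_rung_and_ent` — the route is a COMPLETE two-piece decomposition of the summit into two
  CONSEQUENCES of the summit: `SmoothPoincare4 ↔ SubcylindricalRecognition ∧ SubcylindricalExistence`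
  (`→`: `Negative.spc4_imp` and `subcylindricalExistence_of_spc4`; `←`: the route's `closes`).
* `rung_iff_spc4_of_ent`, `ent_iff_spc4_of_rung` — hence EACH crux is "the summit given the other"; the flagged
  equivalence `ENT ↔ S given RUNG` is one of the two symmetric corollaries and carries no information by itself:
  the content question is whether the sibling RUNG is substantive.
* `ent_iff_spc4_of_leaves` — the same equivalence with RUNG unfolded to the route's current OPEN LEAVES through the
  LANDED reductions (`RecognitionOfShrinkerGaps.subcylindricalRecognition_of_bamler`, p96734, Hamilton short-time
  existence and Perelman monotonicity discharged in the tree; `noncompactGapReduction_proof`, p123839; the compact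
  gap enters as itself):
  ENT ↔ SPC4 given N1 (Bamler 2020a–c, named fact), `ShrinkerSplittingAtInfinity` (MW15/EMT11/Naber10/BB25, named
  fact item), `ConicalGap`, `UnboundedCurvatureGap` (open research problems) and `CompactShrinkerGap` (open; = CGY03
  Thm A + the Weyl budget); `ThreeShrinkerGap` and `BakryEmeryLogSobolev` enter as PROVED tree theorems.
-/

set_option linter.dupNamespace false

namespace Summit.SmoothPoincare4.SmoothPoincare4.Cruxes.SubcylindricalExistence.EquivalenceAuditQ1

open Summit.SmoothPoincare4.SmoothPoincare4.Theses.EntropyRung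
open Summit.SmoothPoincare4.SmoothPoincare4.Theorems
open Literature.Geometry.Riemannian

/-- The route EntropyRung is a complete decomposition of SPC4 into two SPC4-consequences. [folklore] -/
theorem spc4_iff_rung_and_ent :
    _root_.SmoothPoincare4 ↔ (SubcylindricalRecognition ∧ SubcylindricalExistence) :=
  ⟨fun h ↦ ⟨SubcylindricalRecognition.Negative.spc4_imp h, subcylindricalExistence_of_spc4 h⟩,
   fun h ↦ closes h.1 h.2⟩

/-- Symmetric corollary 1: given ENT, the rung is the summit. [folklore] -/
theorem rung_iff_spc4_of_ent (hEnt : SubcylindricalExistence) :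
    SubcylindricalRecognition ↔ _root_.SmoothPoincare4 :=
  ⟨fun hRung ↦ closes hRung hEnt, SubcylindricalRecognition.Negative.spc4_imp⟩

/-- Symmetric corollary 2 (= the flagged witness `subcylindricalExistence_iff_spc4`): given the rung, ENT is the
summit. [folklore] -/
theorem ent_iff_spc4_of_rung (hRung : SubcylindricalRecognition) :
    SubcylindricalExistence ↔ _root_.SmoothPoincare4 :=
  subcylindricalExistence_iff_spc4 hRung

/-- The flagged equivalence with the sibling RUNG unfolded to the route's OPEN LEAVES through the landed
reductions: ENT ↔ SPC4 given Bamler's N1, the splitting-at-infinity fact, the two open non-compact residues and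
the compact gap (the 3-d rung `ThreeShrinkerGap` and the Bakry–Émery LSI are tree theorems and are supplied here,
not assumed). [folklore] -/
theorem ent_iff_spc4_of_leaves (hN1 : bamler_orbifoldTangentFlowAtInfinity_four)
    (hSplit : ShrinkerSplittingAtInfinity) (hConical : ConicalGap) (hUnbounded : UnboundedCurvatureGap)
    (hCompact : CompactShrinkerGap) :
    SubcylindricalExistence ↔ _root_.SmoothPoincare4 := by
  have hNoncompact : NoncompactShrinkerGap :=
    noncompactGapReduction_proof ThreeShrinkerGap.threeShrinkerGap_proof hSplit
      BakryEmeryComplete.bakryEmeryLogSobolev_proof hConical hUnbounded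
  exact subcylindricalExistence_iff_spc4
    (RecognitionOfShrinkerGaps.subcylindricalRecognition_of_bamler hN1 hNoncompact hCompact)

end Summit.SmoothPoincare4.SmoothPoincare4.Cruxes.SubcylindricalExistence.EquivalenceAuditQ1
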